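import Summits.Schanuel.Schanuel.Theorems.RootDecomp1ResidueSieveLogPi

/-!
# RootDecomp1ResidueSieve — continuation (RootDecomp1ResidueSieve): §3 (end) item D (binders verbatim) holds on the singleton cell of z* (disjointSaturatedEssentialSchanuel_piILogPi) + §4 why the (1,1) cell is hard: power lines and PowerValueTwo ⟹ α^{log α}, e^{π²} problems

Part of the four-file split (400-line rule) of lens 1's gen-16 node «ResidueSieve» = HOME/decomp-schanuel-lens-1/g16/RootDecomp1ResidueSieve.lean (sha256 563fa3ea…, 1084 l; ROUND 16 of
route-Schanuel-RootDecomp1, THEOREM ROUND; critic VERDICT 2026-08-30T18:15:03Z ACCEPTED; `--supports stmt-Schanuel-30353`); shared namespace `Summit.Schanuel.Schanuel.Theorems.RootDecomp1ResidueSieve`, node header block repeated; the first part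
(`RootDecomp1ResidueSieveCells`) carries the node docstring. WORDING OF RECORD (critic, binding): «D₃ sieve: residue = Cell(1,1) ∪ Cell(2,0); Cell(2,0) ∩ arg-rich power planes decided CONDITIONALLY on
FourExponentialsConjecture (member z_F certified); D decided (holds) at z* = (π, πi, log π) ON THE DISJOINT STRATUM (ε = 0 is the item's binder) by a = 1, v = 2 (Nesterenko) — Schanuel at z* OPEN;
value-rich members are calibration-grade». Sorry-free; standard axioms. Nothing here proves Schanuel; rung 0.
-/


noncomputable section

namespace Summit.Schanuel.Schanuel.Theorems.RootDecomp1ResidueSieve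

open Complex IntermediateField Module Polynomial
open Literature.NumberTheory.Transcendental (exists_nsmul_mem_span_int nesterenko transcendental_pi_holds
  FourExponentialsConjecture)
open Summit.Schanuel.Schanuel.Theorems.RootDecomp1EAnchor (isAlgebraic_of_mem_adjoin isAlgebraic_mul isAlgebraic_add
  trdeg_adjoin_union_le trdeg_adjoin_le_nat trdeg_adjoin_le_of_isAlgebraic exists_nat_eq_of_le_natCast)
open Summit.Schanuel.Schanuel.Theorems.RootDecomp1EEStableRung (one_le_trdeg_adjoin_of_transcendental
  mul_mem_span_of_gens)
open Summit.Schanuel.Schanuel.Theorems.RootDecomp1ArgumentCells (trdeg_args_le trdeg_vals_le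
  le_trdeg_of_algebraicIndependent_mem le_valDegree_of_exp_algebraic_mem algebraicIndependent_pi_exp_pi
  trdeg_args_le_one_of_isAlgebraic_adjoin_singleton)
open Summit.Schanuel.Schanuel.Theorems.RootDecomp1ValueCells (exp_mem_vals_of_mem_span_int exp_isAlgebraic_vals_of_mem_span)
open Summit.Schanuel.Schanuel.Theorems.RootDecomp1AdditiveCells (linearIndependent_mul_left le_trdeg_of_additive_cert)
open Summit.Schanuel.Schanuel.Theorems.RootDecomp1AdditiveCellsD (pair_one_linearIndependent)

/-- **ITEM D (binders verbatim) HOLDS on the singleton cell `{range z = range z*}`** — bookkeeping form of the member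
certificate, for the cell table. -/
theorem disjointSaturatedEssentialSchanuel_piILogPi (hN : nesterenko) :
    ∀ (n : ℕ), 3 ≤ n → ∀ (z : Fin n → ℂ), LinearIndependent ℚ z →
      (n ≤ 3 ∧ Set.range z = Set.range piILogPi) →
      (∀ i, z i ∈ Literature.NumberTheory.Transcendental.ecl (∅ : Set ℂ)) →
      (∀ (m : ℕ), m < n → ∀ (w : Fin m → ℂ), LinearIndependent ℚ w →
        (∀ i, w i ∈ Submodule.span ℚ (Set.range z)) →
        (m : Cardinal) ≤ Algebra.trdeg ℚ ↥(IntermediateField.adjoin ℚ (Set.range w ∪ Set.range (Complex.exp ∘ w)))) →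
      (∀ w : ℂ, IsAlgebraic ↥(IntermediateField.adjoin ℚ (Set.range z ∪ Set.range (Complex.exp ∘ z))) w →
        IsAlgebraic ↥(IntermediateField.adjoin ℚ (Set.range z ∪ Set.range (Complex.exp ∘ z))) (Complex.exp w) →
        w ∈ Submodule.span ℚ (Set.range z)) →
      (∀ (k : ℕ) (t : Fin k → ℂ) (β₀ γ₀ : Fin n → ℂ) (β γ : Fin n → Fin k → ℂ), (∀ i, IsAlgebraic ℚ (β₀ i)) →
        (∀ i j, IsAlgebraic ℚ (β i j)) → (∀ i, IsAlgebraic ℚ (γ₀ i)) → (∀ i j, IsAlgebraic ℚ (γ i j)) →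
        (∀ i, z i = β₀ i + ∑ j, β i j * t j) → (∀ i, Complex.exp (z i) = γ₀ i + ∑ j, γ i j * t j) → n ≤ k) →
      (∀ (k : ℕ) (t : Fin k → ℂ) (β₀ γ₀ : Fin n → ℂ) (β γ : Fin n → Fin k → ℂ) (δ ε : Fin n → Fin k → Fin k → ℂ),
        (∀ i, IsAlgebraic ℚ (β₀ i)) → (∀ i j, IsAlgebraic ℚ (β i j)) → (∀ i j j', IsAlgebraic ℚ (δ i j j')) →
        (∀ i, IsAlgebraic ℚ (γ₀ i)) → (∀ i j, IsAlgebraic ℚ (γ i j)) → (∀ i j j', IsAlgebraic ℚ (ε i j j')) →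
        (∀ i, z i = β₀ i + ∑ j, β i j * t j + ∑ j, ∑ j', δ i j j' * (t j * t j')) →
        (∀ i, Complex.exp (z i) = γ₀ i + ∑ j, γ i j * t j + ∑ j, ∑ j', ε i j j' * (t j * t j')) → n ≤ k) →
      (∀ (k : ℕ) (t : Fin k → ℂ) (D : MvPolynomial (Fin k) ℂ) (N E : Fin n → MvPolynomial (Fin k) ℂ),
        (∀ m, IsAlgebraic ℚ (MvPolynomial.coeff m D)) → (∀ i m, IsAlgebraic ℚ (MvPolynomial.coeff m (N i))) →
        (∀ i m, IsAlgebraic ℚ (MvPolynomial.coeff m (E i))) → MvPolynomial.eval t D ≠ 0 →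
        (∀ i, z i * MvPolynomial.eval t D = MvPolynomial.eval t (N i)) →
        (∀ i, Complex.exp (z i) * MvPolynomial.eval t D = MvPolynomial.eval t (E i)) → n ≤ k) →
      (Algebra.trdeg ℚ ↥(IntermediateField.adjoin ℚ (Set.range z)) +
          Algebra.trdeg ℚ ↥(IntermediateField.adjoin ℚ (Set.range (Complex.exp ∘ z))) ≤
        Algebra.trdeg ℚ ↥(IntermediateField.adjoin ℚ (Set.range z ∪ Set.range (Complex.exp ∘ z)))) →
      (n : Cardinal) ≤ Algebra.trdeg ℚ ↥(IntermediateField.adjoin ℚ (Set.range z ∪ Set.range (Complex.exp ∘ z))) := by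
  intro n hn z hz hcell _ _ _ _ _ _ hsplit
  obtain rfl : n = 3 := le_antisymm hcell.1 hn
  have e1 : Set.range (Complex.exp ∘ z) = Set.range (cexp ∘ piILogPi) := by
    rw [Set.range_comp, Set.range_comp, hcell.2]
  rw [e1, hcell.2] at hsplit ⊢
  exact disjointSchanuel_piILogPi hN hsplit

/-! ## §4  WHY THE `(1,1)` CELL IS HARD: its power-line sub-cell dominates named open problems

Round 15 typed the power lines `(w, w², w³)`, `w ∉ ℚ̄`, inside cell `(1,1) ∪ decided` with deciding input
«PowerValueTwo(w)»: `2 ≤ trdeg ℚ(e^w, e^{w²}, e^{w³})`.  Two one-line dominations book its hardness: whenever `e^w`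
is ALGEBRAIC, PowerValueTwo(w) says `e^{w²} ∉ ℚ̄` — at `w = log 2` this is the transcendence of `2^{log 2}`, at
`w = πi` that of `e^{π²}` (both classical open problems; the Four Exponentials Conjecture does not give them either). -/

/-- The power line `(w, w², w³)` (round 15's `powerTriple`). -/
def powerLine (w : ℂ) : Fin 3 → ℂ := ![w, w ^ 2, w ^ 3]

/-- **PowerValueTwo(w) with `e^w ∈ ℚ̄` forces `e^{w²} ∉ ℚ̄`** (else all three values lie in `ℚ̄(e^{w³})`, of
transcendence degree `≤ 1`). -/
theorem transcendental_exp_sq_of_powerValueTwo {w : ℂ} (hα : IsAlgebraic ℚ (cexp w))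
    (h : (2 : Cardinal) ≤ Algebra.trdeg ℚ ↥(adjoin ℚ (Set.range (cexp ∘ powerLine w)))) :
    Transcendental ℚ (cexp (w ^ 2)) := by
  intro h2
  set K := adjoin ℚ ({cexp (w ^ 3)} : Set ℂ) with hK
  have hle : Algebra.trdeg ℚ ↥(adjoin ℚ (Set.range (cexp ∘ powerLine w))) ≤ Algebra.trdeg ℚ ↥K := by
    refine trdeg_adjoin_le_of_isAlgebraic ?_
    rintro _ ⟨i, rfl⟩
    fin_cases i
    · simpa [powerLine] using hα.tower_top K
    · simpa [powerLine] using h2.tower_top K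
    · simpa [powerLine] using isAlgebraic_of_mem_adjoin (mem_adjoin_simple_self ℚ (cexp (w ^ 3)))
  have h1 : Algebra.trdeg ℚ ↥K ≤ ((1 : ℕ) : Cardinal) := trdeg_adjoin_le_nat (F := ℚ) _ (by simp)
  have := (h.trans hle).trans h1
  norm_num at this

/-- **At `w = log 2`: PowerValueTwo(log 2) ⟹ `2^{log 2} = e^{(log 2)²}` is transcendental** (open problem). -/
theorem transcendental_two_pow_log_two_of_powerValueTwo
    (h : (2 : Cardinal) ≤ Algebra.trdeg ℚ ↥(adjoin ℚ (Set.range (cexp ∘ powerLine (Real.log 2 : ℂ))))) :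
    Transcendental ℚ (cexp ((Real.log 2 : ℂ) ^ 2)) := by
  refine transcendental_exp_sq_of_powerValueTwo ?_ h
  have e : cexp (Real.log 2 : ℂ) = (2 : ℂ) := by
    rw [← Complex.ofReal_exp, Real.exp_log (by norm_num : (0 : ℝ) < 2)]; norm_num
  rw [e]
  exact isAlgebraic_nat (R := ℚ) (A := ℂ) 2

/-- **At `w = πi`: PowerValueTwo(πi) ⟹ `e^{π²}` is transcendental** (open problem; `e^{(πi)²} = 1/e^{π²}`). -/
theorem transcendental_exp_pi_sq_of_powerValueTwo
    (h : (2 : Cardinal) ≤ Algebra.trdeg ℚ ↥(adjoin ℚ (Set.range (cexp ∘ powerLine ((Real.pi : ℂ) * I))))) :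
    Transcendental ℚ (cexp ((Real.pi : ℂ) ^ 2)) := by
  have hα : IsAlgebraic ℚ (cexp ((Real.pi : ℂ) * I)) := by
    rw [Complex.exp_pi_mul_I]; exact isAlgebraic_one.neg
  have ht := transcendental_exp_sq_of_powerValueTwo hα h
  have e : cexp (((Real.pi : ℂ) * I) ^ 2) = (cexp ((Real.pi : ℂ) ^ 2))⁻¹ := by
    rw [mul_pow, Complex.I_sq, mul_neg, mul_one, Complex.exp_neg]
  rw [e] at ht
  exact fun halg => ht halg.inv

end Summit.Schanuel.Schanuel.Theorems.RootDecomp1ResidueSieve
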